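import Literature.MathematicalPhysics.QuantumFieldTheory.Balaban1983to89.Setup

/-!
# `Balaban1983to89.B12ChiralAction032` — [Balaban1987RG1] (0.32) p. 260: the action of the two-dimensional
nonlinear chiral models, the second model class to which the paper says all its results apply

HONEST FRAMING (cell `lit-balaban`, verbatim): statement-level skeleton of published theorems with citation tags;
proofs where landed; nothing here is a claim about the Yang–Mills mass gap.

CITATION HEADER.  T. Bałaban, *Renormalization group approach to lattice gauge field theories. I. Generation of
effective actions in a small field approximation and a coupling constant renormalization in four dimensions*,
Commun. Math. Phys. **109** (1987) 249–301, doi:10.1007/bf01215223 [Balaban1987RG1] (cell paper B12; held text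
`paper:balaban1987-cmp109-rg-i-small-field`, journal page = PDF page + 248; the display was read from the page render
`b2b-balaban-ref1/pages/1987-cmp109-rg-I-small-field/…-p012-x2.png`).  Unit `lit-balaban-r09`, SKELETON row `B12-0.32`.

WHAT IS PRINTED (p. 260 [PDF 12], verbatim): *«Finally let us mention that all results of this paper are valid for a
certain class of two-dimensional nonlinear σ-models, the so-called nonlinear chiral models. For these models field
configurations are functions U defined on sites of the lattice T, with values in the Lie group G, and the action is
given by  A(U) = Σ_{b⊂T} [1 − Re tr U(∂b)],  U(∂b) = (∂U)(b) = U(b₋)U⁻¹(b₊). (0.32)  In fact all the results were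
obtained at first for this class of models. They are technically much easier, and many modifications and
simplications are possible in this case; therefore we will discuss them separately in the future.»*

WHAT THIS MODULE TYPES: the site-field configuration space, the bond variable `U(∂b)` and the action (0.32) over
the cell vocabulary `Setup` (tori `Site P j`, positively oriented bonds `PBond`, the gauge-group interface with the
normalised trace `reTr`).  Nothing is asserted: the sentence "all results of this paper are valid for [these
models]" is a CLAIM of the paper whose proof is announced for a future publication and is not typed as a fact.
-/

namespace Literature.MathematicalPhysics.QuantumFieldTheory.Balaban1983to89.B12ChiralAction032

open Literature.MathematicalPhysics.QuantumFieldTheory.Balaban1983to89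

variable {P : Params} {j : ℕ} {G : Type*} [GaugeGroup G]

variable (P j G) in
/-- Field configurations of the nonlinear chiral model: "functions U defined on sites of the lattice T, with values
in the Lie group G". [cite: Balaban1987RG1, (0.32) p.260] -/
abbrev ChiralField : Type _ := Site P j → G

/-- The bond variable `U(∂b) = (∂U)(b) = U(b₋)U⁻¹(b₊)` of (0.32). [cite: Balaban1987RG1, (0.32) p.260] -/
def chiralBond (U : ChiralField P j G) (b : PBond P j) : G := U b.src * (U b.tgt)⁻¹

/-- The action of the nonlinear chiral model, `A(U) = Σ_{b⊂T} [1 − Re tr U(∂b)]` (0.32) (`tr` normalised,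
`Setup.GaugeGroup.reTr`; the sum over the positively oriented bonds of `T^{(j)}`). [cite: Balaban1987RG1, (0.32) p.260] -/
noncomputable def chiralAction (U : ChiralField P j G) : ℝ :=
  ∑ b : PBond P j, (1 - reTr (chiralBond U b))

/-- Each term `1 − Re tr U(∂b)` of (0.32) is non-negative (`Re tr ≤ 1` in the interface), so `A(U) ≥ 0` — the
same elementary positivity as for the Wilson action (0.2) (`Setup.wilsonAction4_nonneg`). [cite: Balaban1987RG1, (0.32) p.260] -/
theorem chiralAction_nonneg (U : ChiralField P j G) : 0 ≤ chiralAction U := by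
  unfold chiralAction
  refine Finset.sum_nonneg fun b _ => ?_
  have := GaugeGroup.reTr_le_one (chiralBond U b)
  linarith

/-- The constant configuration has zero action (`U(∂b) = 1`, `Re tr 1 = 1`). [cite: Balaban1987RG1, (0.32) p.260] -/
theorem chiralAction_const (g : G) : chiralAction (fun _ : Site P j => g) = 0 := by
  unfold chiralAction chiralBond
  simp [GaugeGroup.reTr_one]

end Literature.MathematicalPhysics.QuantumFieldTheory.Balaban1983to89.B12ChiralAction032
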